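import Summits.ValiantsHypothesis.ValiantsHypothesis.Theorems.SuccinctLiftSmlCircuit
import Summits.ValiantsHypothesis.ValiantsHypothesis.Theorems.DepthWindowHomImmHardLt

/-!
# SuccinctLift — the Limaye–Srinivasan–Tavenas bound over ANY field, for GENERAL circuits (Forbes 2024)

Support file for wall D of `route-ValiantsHypothesis-SuccinctLift` (stmt-ValiantsHypothesis-23721,
census cell W34 «2-non-unit cut», whose VP-internal leaf lives over `𝔽̄₂`).  Forbes (CCC 2024)
proved that the super-polynomial lower bounds of Limaye–Srinivasan–Tavenas against low-depth
algebraic circuits hold over EVERY field, by replacing the characteristic-zero homogenisation step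
with a direct low-depth SET-MULTILINEARISATION.  This file runs that argument in the kernel, in the
tree's (product-depth, wires) currency and at the growing depth `σ · log₂log₂log₂ m` of the
workshop's dial: a general circuit `D` (no homogeneity assumption, any field `K`) for
`IMM_{m,⌊√log₂ m⌋}` of product depth `≤ ⌊p·L₃(m)/q⌋ + c` is normalised (`exists_size_le_edgeSize`),
set-multilinearised (`SuccinctLiftSmlCircuit.exists_sml_circuit`: product depth doubles, size grows by
the factor `γ(d) ≤ m²`, all gate values become homogeneous) and fed to the homogeneous engine
`DepthWindow.homLst_geom_solved`, which is valid over every field; the outcome is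
`immHard_anyField`: for `2p < q` (relative depth `σ < 1/2`) such circuits have `> m^c + c` wires for
all large `m`.  `homImmHard_coreK` is the field-generic reading of `DepthWindow.homImmHard_core`
(whose statement is typed over `ℂ` although its proof is not).

References: Forbes2024LowDepth (CCC 2024, Thm. 1, §1.2); LimayeSrinivasanTavenas2025 (J. ACM 72,
Lemma 12, Cor. 4); BhargavDuttaSaxena2024 (Lemma 7).
-/

noncomputable section

open MvPolynomial

-- the summit and the problem share the name `ValiantsHypothesis` (D-0017 single-conjunct layout)
set_option linter.dupNamespace false

namespace Summit.ValiantsHypothesis.ValiantsHypothesis.Theorems.SuccinctLiftSmlAnyField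

open Literature.Computability.AlgebraicComplexity ArithCircuit
open SuccinctLiftSmlConvolution SuccinctLiftSmlCircuit DepthWindow

universe u

/-! ### `IMM` is set-multilinear in its layers, over any commutative semiring -/

/-- Every entry of the ordered product of the generic matrices `X^{(t)}`, `t ∈ l`, is weighted
homogeneous of block weight `∑_{t ∈ l} e_t` for the layer map `Prod.fst` (field-generic reading of
`DepthWindow.Riffle.isWeightedHomogeneous_immMatrix_list_prod`). [folklore] -/
theorem isWeightedHomogeneous_immMatrix_list_prod (K : Type u) [CommSemiring K] {n : Type}
    [Fintype n] [DecidableEq n] (d : ℕ) (l : List (Fin d)) (i j : n) :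
    IsWeightedHomogeneous (blockWeight (Prod.fst : Fin d × n × n → Fin d))
      (((l.map fun t => (Matrix.mvPolynomialX n n K).map
        (rename fun ij : n × n => (t, ij))).prod) i j)
      ((l.map fun t => (Finsupp.single t 1 : Fin d →₀ ℕ)).sum) := by
  induction l generalizing i j with
  | nil =>
    simp only [List.map_nil, List.prod_nil, List.sum_nil]
    by_cases h : i = j
    · subst h; simpa using isWeightedHomogeneous_one K _
    · simpa [Matrix.one_apply_ne h] using isWeightedHomogeneous_zero K _ _
  | cons t l ih =>
    simp only [List.map_cons, List.prod_cons, List.sum_cons]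
    rw [Matrix.mul_apply]
    refine IsWeightedHomogeneous.sum _ _ _ fun x _ => ?_
    have h1 : IsWeightedHomogeneous (blockWeight (Prod.fst : Fin d × n × n → Fin d))
        ((Matrix.mvPolynomialX n n K).map (rename fun ij : n × n => (t, ij)) i x)
        (Finsupp.single t 1) := by
      simpa [Matrix.mvPolynomialX, Matrix.map_apply, blockWeight] using
        isWeightedHomogeneous_X K (blockWeight (Prod.fst : Fin d × n × n → Fin d)) (t, (i, x))
    exact h1.mul (ih x j)

/-- `IMM_{m,d} = tr(X⁽⁰⁾⋯X⁽ᵈ⁻¹⁾)` is set-multilinear over all `d` layers, over any commutative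
semiring. [cite: LimayeSrinivasanTavenas2025, §2] -/
theorem isSetMultilinear_immPoly (K : Type u) [CommSemiring K] (m d : ℕ) :
    IsSetMultilinear (Prod.fst : Fin d × Fin m × Fin m → Fin d) Finset.univ (immPoly m d K) := by
  classical
  unfold IsSetMultilinear immPoly immMatrix Matrix.trace
  have hprof : blockProfile (Finset.univ : Finset (Fin d)) =
      ((List.finRange d).map fun t => (Finsupp.single t 1 : Fin d →₀ ℕ)).sum := by
    rw [blockProfile, Fin.sum_univ_def]
  rw [hprof]
  refine IsWeightedHomogeneous.sum _ _ _ fun i _ => ?_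
  simpa [Matrix.diag] using isWeightedHomogeneous_immMatrix_list_prod K (n := Fin m) d (List.finRange d) i i

/-! ### Arithmetic of the conversion factor -/

/-- `γ(⌊√L⌋) ≤ 2^L · 2^L` for `L ≥ 100`. [folklore] -/
theorem gamma_le (L d : ℕ) (hd : d = Nat.sqrt L) (hL : 100 ≤ L) : gamma d ≤ 2 ^ L * 2 ^ L := by
  have hd10 : 10 ≤ d := by rw [hd]; exact Nat.le_sqrt.2 (by omega)
  have hdd : d * d ≤ L := by rw [hd]; exact Nat.sqrt_le L
  have h4 : (4 : ℕ) ^ d = 2 ^ (2 * d) := by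
    rw [pow_mul]; norm_num
  have hdpow : d ^ d ≤ 2 ^ L := by
    calc d ^ d ≤ (2 ^ d) ^ d := Nat.pow_le_pow_left (Nat.lt_two_pow_self).le d
      _ = 2 ^ (d * d) := by rw [← pow_mul]
      _ ≤ 2 ^ L := Nat.pow_le_pow_right (by norm_num) hdd
  have hd2 : d + 2 ≤ 2 ^ (d + 2) := (Nat.lt_two_pow_self).le
  have h3d : 3 * d + 4 ≤ L := by nlinarith
  unfold gamma
  calc 4 * (4 ^ d * d ^ d * (d + 2)) ≤ 2 ^ 2 * (2 ^ (2 * d) * 2 ^ L * 2 ^ (d + 2)) := by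
        rw [h4]; exact Nat.mul_le_mul (by norm_num) (Nat.mul_le_mul (Nat.mul_le_mul_left _ hdpow) hd2)
    _ = 2 ^ (3 * d + 4) * 2 ^ L := by
        rw [show 3 * d + 4 = 2 + 2 * d + (d + 2) by ring, pow_add, pow_add]; ring
    _ ≤ 2 ^ L * 2 ^ L := Nat.mul_le_mul_right _ (Nat.pow_le_pow_right (by norm_num) h3d)

/-! ### The homogeneous engine, over any field -/

/-- **The kernel of `Hard(σ)`, `σ < 1`, for HOMOGENEOUS circuits over ANY field** — the field-generic
reading of `DepthWindow.homImmHard_core` (same proof; the engine `homLst_geom_solved` is typed over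
every field): with `L = ⌊log₂ m⌋`, `d = ⌊√L⌋`, a circuit for `IMM_{m,d}` all of whose gate values are
homogeneous and of product depth `≤ ⌊p ⌊log₂⌊log₂ L⌋⌋/q⌋ + c` has `> m^c + c` gates, for `m ≥ 2^{max L₀ 100}`.
[cite: LimayeSrinivasanTavenas2025, Cor. 4] [cite: BhargavDuttaSaxena2024, Lemma 7] -/
theorem homImmHard_coreK (K : Type u) [Field K] (p q c : ℕ) (hpq : p < q) {L₀ : ℕ}
    (hL₀ : ∀ L : ℕ, L₀ ≤ L → (140 * (c + 1) * (p * Nat.log 2 (Nat.log 2 L) / q + c + 1)) ^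
      2 ^ (p * Nat.log 2 (Nat.log 2 L) / q + c + 1 + 1) ≤ L)
    (m : ℕ) (hm : 2 ^ max L₀ 100 ≤ m) {d L : ℕ} (hL : L = Nat.log 2 m) (hd : d = Nat.sqrt L)
    (D : ArithCircuit K (Fin d × Fin m × Fin m))
    (hhom : ∀ v ∈ ArithCircuit.gateValues D.gates, ∃ e : ℕ, v.IsHomogeneous e)
    (hD : D.Computes (immPoly m d K)) (hpd : D.productDepth ≤ p * Nat.log 2 (Nat.log 2 L) / q + c) :
    m ^ c + c < D.size := by
  have hq : 0 < q := by omega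
  have hLge : max L₀ 100 ≤ L := by rw [hL]; exact Nat.le_log_of_pow_le (by norm_num) hm
  have hL0 : L₀ ≤ L := le_trans (le_max_left _ _) hLge
  have hL100 : 100 ≤ L := le_trans (le_max_right _ _) hLge
  have hd10 : 10 ≤ d := by rw [hd]; exact Nat.le_sqrt.2 (by omega)
  have hdd : d * d ≤ L := by rw [hd]; exact Nat.sqrt_le L
  have hdn : 10 * d ≤ L := le_trans (Nat.mul_le_mul_right d hd10) hdd
  have hdnm : 10 * d ≤ Nat.log 2 m := hL ▸ hdn
  have hd1 : 1 ≤ d := by omega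
  set Δ' := p * Nat.log 2 (Nat.log 2 L) / q + c + 1 with hΔ'
  have hpd' : D.productDepth ≤ Δ' := by omega
  have hΔ1 : 1 ≤ Δ' := by omega
  -- the fit, in `ℕ` and then in `ℝ`
  have hfitN : (140 * (c + 1) * Δ') ^ 2 ^ (Δ' + 1) ≤ L := hL₀ L hL0
  have hAd : (140 * (c + 1) * Δ') ^ 2 ^ Δ' ≤ d := by
    rw [hd, Nat.le_sqrt', ← pow_mul, ← pow_succ]
    exact hfitN
  have hx : 1 ≤ 70 * (c + 1) * Δ' := by nlinarith
  have hfit : ((70 * (c + 1) * Δ' : ℕ) : ℝ) ^ (2 ^ Δ' - 1) * 2 ^ (2 ^ Δ') ≤ (d : ℝ) := by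
    have h1 : (70 * (c + 1) * Δ') ^ (2 ^ Δ' - 1) * 2 ^ (2 ^ Δ') ≤ (140 * (c + 1) * Δ') ^ 2 ^ Δ' := by
      calc (70 * (c + 1) * Δ') ^ (2 ^ Δ' - 1) * 2 ^ (2 ^ Δ')
          ≤ (70 * (c + 1) * Δ') ^ (2 ^ Δ') * 2 ^ (2 ^ Δ') :=
            Nat.mul_le_mul_right _ (Nat.pow_le_pow_right hx (Nat.sub_le _ _))
        _ = (140 * (c + 1) * Δ') ^ 2 ^ Δ' := by rw [← mul_pow]; congr 1; ring
    exact_mod_cast h1.trans hAd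
  have hlam : (1 : ℝ) ≤ ((70 * (c + 1) * Δ' : ℕ) : ℝ) := by exact_mod_cast hx
  have h := homLst_geom_solved K hΔ1 m d hd1 hlam hfit hdnm D hpd' hhom hD
  rw [← hL] at h
  -- the exponent is at least `3 (c+1) L`
  have hexp : (((3 * (c + 1) * L : ℕ) : ℝ)) ≤
      (L : ℝ) * ((((70 * (c + 1) * Δ' : ℕ) : ℝ)) - 10) / (20 * (Δ' : ℝ)) := by
    have hΔR : (1 : ℝ) ≤ Δ' := by exact_mod_cast hΔ1
    have hLR : (0 : ℝ) ≤ L := Nat.cast_nonneg _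
    have hcR : (0 : ℝ) ≤ c := Nat.cast_nonneg _
    have hkey : (0 : ℝ) ≤ (L : ℝ) * (((c : ℝ) + 1) * Δ' - 1) := mul_nonneg hLR (by nlinarith)
    rw [le_div_iff₀ (by positivity)]
    push_cast
    nlinarith [hkey]
  have hN : 2 ^ (3 * (c + 1) * L) ≤ D.size * d ^ d + 1 := by
    have h1 := (Real.rpow_le_rpow_of_exponent_le one_le_two hexp).trans h
    rw [Real.rpow_natCast] at h1
    exact_mod_cast h1
  -- suppose the circuit were small
  by_contra hs
  push Not at hs
  have hm2 : m < 2 ^ (L + 1) := by rw [hL]; exact Nat.lt_pow_succ_log_self one_lt_two m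
  have hmc : m ^ c ≤ 2 ^ ((L + 1) * c) := by
    rw [pow_mul]; exact Nat.pow_le_pow_left hm2.le c
  have hmcc : m ^ c + c ≤ 2 ^ ((L + 1) * c + c) := by
    have h1 : c + 1 ≤ 2 ^ c := Nat.lt_two_pow_self
    have h2 : 1 ≤ 2 ^ ((L + 1) * c) := Nat.one_le_two_pow
    calc m ^ c + c ≤ 2 ^ ((L + 1) * c) + 2 ^ ((L + 1) * c) * c := by nlinarith
      _ = 2 ^ ((L + 1) * c) * (c + 1) := by ring
      _ ≤ 2 ^ ((L + 1) * c) * 2 ^ c := Nat.mul_le_mul_left _ h1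
      _ = 2 ^ ((L + 1) * c + c) := by rw [← pow_add]
  have hddL : d ^ d ≤ 2 ^ L := by
    calc d ^ d ≤ (2 ^ d) ^ d := Nat.pow_le_pow_left (Nat.lt_two_pow_self).le d
      _ = 2 ^ (d * d) := by rw [← pow_mul]
      _ ≤ 2 ^ L := Nat.pow_le_pow_right (by norm_num) hdd
  have hup : D.size * d ^ d + 1 ≤ 2 ^ ((L + 1) * c + c + L + 1) := by
    have h1 : D.size * d ^ d ≤ 2 ^ ((L + 1) * c + c + L) := by
      rw [pow_add]; exact Nat.mul_le_mul (hs.trans hmcc) hddL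
    have h2 : 1 ≤ 2 ^ ((L + 1) * c + c + L) := Nat.one_le_two_pow
    rw [pow_succ]; omega
  have hfin := (Nat.pow_le_pow_iff_right (by norm_num)).1 (hN.trans hup)
  have hcL : c ≤ c * L := Nat.le_mul_of_pos_right c (by omega)
  nlinarith [hcL]

/-! ### The theorem: LST over any field, general circuits, relative depth `σ < 1/2` -/

/-- **Limaye–Srinivasan–Tavenas over ANY field, general circuits** (Forbes, CCC 2024, in the
kernel): for every field `K`, every slope `p/q < 1/2` and every `c`, for all large `m`, every
algebraic circuit over `K` (unbounded fan-in, arbitrary constants, NO homogeneity assumption)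
computing `IMM_{m,⌊√⌊log₂ m⌋⌋}` in product depth `≤ ⌊p·⌊log₂⌊log₂⌊log₂ m⌋⌋⌋/q⌋ + c` has more than
`m^c + c` wires.  Proof: normalise, set-multilinearise at low depth (`exists_sml_circuit`, depth
`× 2`, size `× γ(d) ≤ m²`, all gate values homogeneous), and apply the homogeneous engine over `K`
(`homImmHard_coreK` at slope `2p/q < 1` and exponent `2c + 3`).
[cite: Forbes2024LowDepth, Thm. 1, §1.2] [cite: LimayeSrinivasanTavenas2025, Lemma 12, Cor. 4] -/
theorem immHard_anyField (K : Type u) [Field K] {p q : ℕ} (hpq : 2 * p < q) (c : ℕ) :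
    ∃ m₁ : ℕ, ∀ m : ℕ, m₁ ≤ m →
      ∀ D : ArithCircuit K (Fin (Nat.sqrt (Nat.log 2 m)) × Fin m × Fin m),
        D.Computes (immPoly m (Nat.sqrt (Nat.log 2 m)) K) →
        D.productDepth ≤ p * Nat.log 2 (Nat.log 2 (Nat.log 2 m)) / q + c → m ^ c + c < D.edgeSize := by
  obtain ⟨L₀, hL₀⟩ := homFit_eventually (2 * p) q (2 * c + 3) hpq
  refine ⟨2 ^ max L₀ 100 + (2 * c + 2), fun m hm D hD hpd => ?_⟩
  have hm' : 2 ^ max L₀ 100 ≤ m := le_trans (Nat.le_add_right _ _) hm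
  have hmc : 2 * c + 2 ≤ m := le_trans (Nat.le_add_left _ _) hm
  have h100 : 2 ^ 100 ≤ m := le_trans (Nat.pow_le_pow_right (by norm_num) (le_max_right _ _)) hm'
  have hm0 : m ≠ 0 := by omega
  have hL100 : 100 ≤ Nat.log 2 m := Nat.le_log_of_pow_le (by norm_num) h100
  have h2L : 2 ^ Nat.log 2 m ≤ m := Nat.pow_log_le_self 2 hm0
  by_contra hle
  push Not at hle
  obtain ⟨D', hD'e, hD'd, hD'w, hD's⟩ := exists_size_le_edgeSize D
  obtain ⟨H, hH, hhom, hHpd, hHsize, -⟩ :=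
    exists_sml_circuit (Prod.fst : Fin (Nat.sqrt (Nat.log 2 m)) × Fin m × Fin m → Fin _) D'
  have hHc : H.Computes (immPoly m (Nat.sqrt (Nat.log 2 m)) K) := by
    rw [Computes, hH, hD'e, show D.eval = immPoly m _ K from hD,
      IsSetMultilinear.smlProj_eq _ (isSetMultilinear_immPoly K m _)]
  have hHpd' : H.productDepth ≤ 2 * p * Nat.log 2 (Nat.log 2 (Nat.log 2 m)) / q + (2 * c + 3) := by
    have h1 : 2 * (p * Nat.log 2 (Nat.log 2 (Nat.log 2 m)) / q) ≤
        2 * p * Nat.log 2 (Nat.log 2 (Nat.log 2 m)) / q := by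
      rw [mul_assoc]; exact Nat.mul_div_le_mul_div_assoc _ _ _
    calc H.productDepth ≤ 2 * D'.productDepth := hHpd
      _ ≤ 2 * D.productDepth := Nat.mul_le_mul_left 2 hD'd
      _ ≤ 2 * (p * Nat.log 2 (Nat.log 2 (Nat.log 2 m)) / q + c) := Nat.mul_le_mul_left 2 hpd
      _ = 2 * (p * Nat.log 2 (Nat.log 2 (Nat.log 2 m)) / q) + 2 * c := by rw [mul_add]
      _ ≤ _ := add_le_add h1 (by omega)
  have hcore := homImmHard_coreK K (2 * p) q (2 * c + 3) hpq hL₀ m hm' rfl rfl H hhom hHc hHpd'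
  have hγ : gamma (Nat.sqrt (Nat.log 2 m)) ≤ m * m :=
    (gamma_le (Nat.log 2 m) _ rfl hL100).trans (Nat.mul_le_mul h2L h2L)
  have hDD : D'.edgeSize + D'.size ≤ 2 * (m ^ c + c) := by omega
  have hsz : H.size ≤ 2 * (m ^ c + c) * (m * m) := hHsize.trans (Nat.mul_le_mul hDD hγ)
  have hm1 : 1 ≤ m := by omega
  have hmc1 : 1 ≤ m ^ c := Nat.one_le_pow _ _ hm1
  have e1 : c * (m * m) ≤ c * m ^ c * (m * m) := by
    have h1 : c * 1 ≤ c * m ^ c := Nat.mul_le_mul_left c hmc1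
    rw [mul_one] at h1
    exact Nat.mul_le_mul_right _ h1
  have hfin : 2 * (m ^ c + c) * (m * m) ≤ m ^ (2 * c + 3) + (2 * c + 3) := by
    calc 2 * (m ^ c + c) * (m * m) = 2 * m ^ c * (m * m) + 2 * (c * (m * m)) := by ring
      _ ≤ 2 * m ^ c * (m * m) + 2 * (c * m ^ c * (m * m)) :=
          Nat.add_le_add_left (Nat.mul_le_mul_left 2 e1) _
      _ = (2 + 2 * c) * m ^ c * (m * m) := by ring
      _ ≤ m * m ^ c * (m * m) := Nat.mul_le_mul_right _ (Nat.mul_le_mul_right _ (by omega))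
      _ = m ^ (c + 3) := by ring
      _ ≤ m ^ (2 * c + 3) := Nat.pow_le_pow_right hm1 (by omega)
      _ ≤ _ := Nat.le_add_right _ _
  omega

end Summit.ValiantsHypothesis.ValiantsHypothesis.Theorems.SuccinctLiftSmlAnyField
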